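import Summits.BirchSwinnertonDyer.BirchSwinnertonDyer.Theses.PlecticLegs
import Literature.NumberTheory.EllipticCurves.AnalyticRank
import Literature.NumberTheory.EllipticCurves.QuadraticTwist
import Summits.BirchSwinnertonDyer.BirchSwinnertonDyer.Theorems.PlecticLegsPlecticPointsLBStubFactorOrders
import Summits.BirchSwinnertonDyer.BirchSwinnertonDyer.Theorems.PlecticLegsPlecticPointsLBStubBalancedChart
import HarnessLib

/-!
# Line `conjugate-pigeonhole` for crux `PlecticLegs.PlecticPointsLB` (stmt-BirchSwinnertonDyer-17518)

Lead prover's skeleton (seat `prover-line-stmt-BirchSwinnertonDyer-17518-0`, 2026-08-17), reconstructed from the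
idea card `Cruxes/PlecticPointsLB/Ideas/conjugate-pigeonhole.md` (the ideator's `Sketch.lean` lives in the gate's
evidence store, which is not mounted in a prover's jail; the card quotes its declarations in full).

## The crux (recall)

`PlecticPointsLB : ∀ F` totally real, `d = [F:ℚ] ≥ 2`, `∀ V/F` elliptic, `r_an(V/F) = d → d ≤ rank_ℤ V(F)`.

## The line: exact order `d` over `d` vanishing factors forces order ONE factorwise

Lever (card): whenever `L(V/F,s)` FACTORS on `Re s > 3/2` as a product of `d` entire functions `g₁,…,g_d` which
ALL vanish at `s = 1` (Galois-rigidity of central vanishing along an `Aut ℂ`-orbit of newforms, Shimura 1977;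
automatic on a balanced quadratic base change), the EXACT total order `d = r_an(V/F)` forces every factor to
have order EXACTLY one (pigeonhole over additivity of `analyticOrderAt`), and order one is the configuration the
classical engines convert into rank (Gross–Zagier–Kolyvagin(-Logachev), Milne's invariance of BSD under
restriction of scalars).  Three registered stubs:

* **A · `stub_factorOrders` — the analytic lever (closable now).** For any Weierstrass curve `V` over a number
  field and any factorisation of `V.entireLFunction` on `Re s > 3/2` into `d ≥ 1` entire factors all vanishing
  at `1`: `V.analyticRank = d ⇒` every factor has `analyticOrderAt · 1 = 1`.  (The factorisation bootstraps
  `V.HasEntireLFunction` through `WeierstrassCurve.subsingleton_entireContinuations`, so no continuation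
  hypothesis is needed.)
* **B · `stub_balancedChart` — the balanced quadratic chart at `d = 2` (closable now, GZK instances as
  hypotheses).** `V = E_K` for `E/ℚ` and `K` quadratic, `L(E,s)` and `L(E^{(d_K)},s)` entire and BOTH
  vanishing at `1`, the two Gross–Zagier–Kolyvagin instances `r_an ≤ 1 ⇒ r_an = rank` for `E` and `E^{(d_K)}`
  (= the route's support item `RankLeOne` at these two curves), and `r_an(E_K) = 2`: then `rank E(K) ≥ 2`.
  Tree inputs: Artin formalism `WeierstrassCurve.analyticRankOver_eq_add_of_finrank_eq_two`, Mordell–Weil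
  `WeierstrassCurve.module_finite_point_holds`, `WeierstrassCurve.mordellWeilRank_baseChange_of_finrank_eq_two_of_finite`.
* **T · `stub_atlas` — the transfer (the line's hardest stub, held by the lead).** Every `(F, V)` in the plectic
  regime is EITHER a balanced quadratic base change as in B, OR carries a factorisation as in A together with the
  order-one engine "all factors of exact order one ⇒ `[F:ℚ] ≤ rank`".  The card itself records `Transfer: none`
  (the charts (RM) ∪ (BAL) do not cover automorphically primitive `V`, nor the route's own unbalanced silent base
  changes); the lead's task on T is to settle this precisely (expected: T is crux-equivalent as typed, because the
  trivial factorisation `g₀ = L/(s-1)^{d-1}`, `gᵢ = s - 1` makes the engine clause the crux's conclusion).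

`PlecticPointsLB_of : A → B → T → PlecticPointsLB` is sorry-free; every stub is used.

Disproof.lean: none existed at skeleton registration (07:36Z); the cycle-1 Disproof.lean (08:32Z) breaks 0/3 of these stubs
and independently records T as crux-equivalent.  Original note: none at 2026-08-17T07:30Z (payload.disproof_path not mounted / not yet
written; `ledger crux ls` shows no Disproof.lean) — nothing to honour yet.  Negatives index (BSD): `TamePinch`
only, untouched (no image-of-Galois hypothesis occurs here).

Sorries: after wave 1 exactly ONE, inside `stub_atlas` (A and B are closed by imported Theorems); zero elsewhere.
-/

set_option linter.dupNamespace false -- `Summit.BirchSwinnertonDyer.BirchSwinnertonDyer.…`: single-conjunct summit, Sub = Summit (D-0017)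
set_option linter.unusedVariables false -- stub bodies are `sorry`: every binder is "unused" until closed

namespace Summit.BirchSwinnertonDyer.BirchSwinnertonDyer.Cruxes.PlecticPointsLB.ConjugatePigeonhole

open Summit.BirchSwinnertonDyer.BirchSwinnertonDyer.Theses.PlecticLegs

/-! ## The three registered stubs -/

/-- **A · `stub_factorOrders` — the analytic lever.** For a Weierstrass curve `V` over a number field `F`, if
`V.entireLFunction` agrees on `Re s > 3/2` with a product of `d ≥ 1` entire functions `g i` all vanishing at
`s = 1`, and `V.analyticRank = d`, then every factor vanishes to order EXACTLY one at `s = 1`.  Pigeonhole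
(`d` factors, each of order `≥ 1`, total order `d`) over additivity of `analyticOrderAt` on products, after the
identity theorem (`WeierstrassCurve.subsingleton_entireContinuations`) has upgraded the half-plane factorisation
to a global one.  Size S. [folklore] -/
theorem stub_factorOrders :
    ∀ (F : Type) [Field F] [NumberField F] (V : WeierstrassCurve F) (d : ℕ) (g : Fin d → ℂ → ℂ),
      0 < d → (∀ i, Differentiable ℂ (g i)) →
      (∀ s : ℂ, (3 / 2 : ℝ) < s.re → V.entireLFunction s = ∏ i, g i s) →
      (∀ i, g i 1 = 0) → V.analyticRank = d → ∀ i, analyticOrderAt (g i) 1 = 1 :=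
  -- CLOSED (wave 1, p148795): `Theorems/PlecticLegsPlecticPointsLBStubFactorOrders.lean`
  Summit.BirchSwinnertonDyer.BirchSwinnertonDyer.Theorems.stub_factorOrders

/-- **B · `stub_balancedChart` — the balanced quadratic chart of the crux at `d = 2`.** For `E/ℚ` elliptic
(model `W`) and a quadratic number field `K` (discriminant `d_K`): if `L(E,s)` and `L(E^{(d_K)},s)` are entire
and both vanish at `s = 1`, if Gross–Zagier–Kolyvagin holds for `E` and for `E^{(d_K)}` (`r_an ≤ 1 ⇒ r_an = rank`,
the route's support item `RankLeOne` at these two curves), and if `r_an(E_K) = 2`, then `rank_ℤ E(K) ≥ 2`.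
Chain: `r_an(E_K) = r_an(E) + r_an(E^{(d_K)})` (Artin formalism, tree theorem
`WeierstrassCurve.analyticRankOver_eq_add_of_finrank_eq_two`), both summands `≥ 1`, so both `= 1` (the lever at
`d = 2`); GZK gives ranks `1, 1`; `rank E(K) = rank E(ℚ) + rank E^{(d_K)}(ℚ)` (tree theorem
`WeierstrassCurve.mordellWeilRank_baseChange_of_finrank_eq_two_of_finite`, Mordell–Weil
`WeierstrassCurve.module_finite_point_holds`).  Size S–M. [folklore] -/
theorem stub_balancedChart :
    ∀ (W : WeierstrassCurve ℚ) [W.IsElliptic] (K : Type) [Field K] [NumberField K],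
      Module.finrank ℚ K = 2 →
      W.HasEntireLFunction → (W.quadraticTwist (NumberField.discr K : ℚ)).HasEntireLFunction →
      W.entireLFunction 1 = 0 → (W.quadraticTwist (NumberField.discr K : ℚ)).entireLFunction 1 = 0 →
      (W.analyticRank ≤ 1 → W.analyticRank = W.mordellWeilRank) →
      ((W.quadraticTwist (NumberField.discr K : ℚ)).analyticRank ≤ 1 →
        (W.quadraticTwist (NumberField.discr K : ℚ)).analyticRank =
          (W.quadraticTwist (NumberField.discr K : ℚ)).mordellWeilRank) →
      (W.baseChange K).analyticRank = 2 → 2 ≤ (W.baseChange K).mordellWeilRank :=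
  -- CLOSED (wave 1, p149951): `Theorems/PlecticLegsPlecticPointsLBStubBalancedChart.lean`
  Summit.BirchSwinnertonDyer.BirchSwinnertonDyer.Theorems.stub_balancedChart

/-- **T · `stub_atlas` — the transfer: every plectic-regime curve is on a chart.** For `F` totally real of
degree `d ≥ 2` and `V/F` elliptic with `r_an(V/F) = d`: EITHER `d = 2` and `V` is literally the base change of
an elliptic `E/ℚ` lying on the balanced quadratic chart of `stub_balancedChart` (both `L(E,s)`, `L(E^{(d_F)},s)`
entire and vanishing at `1`, with the two GZK instances), OR `L(V/F,s)` factors on `Re s > 3/2` into `d` entire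
functions all vanishing at `1` such that "every factor of exact order one ⇒ `d ≤ rank_ℤ V(F)`" (the order-one
engine: Shimura rigidity + Gross–Zagier + Kolyvagin–Logachev + Milne + Faltings on the (RM) chart of ℚ-curves).
This is the stub the line is expected to die on: off the charts (automorphically primitive `V`; unbalanced
silent base changes, which are ALL the instances the route's `closes` uses) no arithmetic factorisation exists,
and the abstract one (`g₀ = L/(s-1)^{d-1}`, `gᵢ = s-1`) turns the engine clause into the crux's own conclusion.
Size: crux-equivalent (see `Lines/sketch-conjugate-pigeonhole.dead.md` when written). [folklore] -/
theorem stub_atlas :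
    ∀ (F : Type) [Field F] [NumberField F] [NumberField.IsTotallyReal F] (V : WeierstrassCurve F)
      [V.IsElliptic], 2 ≤ Module.finrank ℚ F → V.analyticRank = Module.finrank ℚ F →
      (∃ W : WeierstrassCurve ℚ, W.IsElliptic ∧ Module.finrank ℚ F = 2 ∧ V = W.baseChange F ∧
          W.HasEntireLFunction ∧ (W.quadraticTwist (NumberField.discr F : ℚ)).HasEntireLFunction ∧
          W.entireLFunction 1 = 0 ∧ (W.quadraticTwist (NumberField.discr F : ℚ)).entireLFunction 1 = 0 ∧
          (W.analyticRank ≤ 1 → W.analyticRank = W.mordellWeilRank) ∧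
          ((W.quadraticTwist (NumberField.discr F : ℚ)).analyticRank ≤ 1 →
            (W.quadraticTwist (NumberField.discr F : ℚ)).analyticRank =
              (W.quadraticTwist (NumberField.discr F : ℚ)).mordellWeilRank)) ∨
      (∃ g : Fin (Module.finrank ℚ F) → ℂ → ℂ,
        (∀ i, Differentiable ℂ (g i)) ∧
        (∀ s : ℂ, (3 / 2 : ℝ) < s.re → V.entireLFunction s = ∏ i, g i s) ∧
        (∀ i, g i 1 = 0) ∧
        ((∀ i, analyticOrderAt (g i) 1 = 1) → Module.finrank ℚ F ≤ V.mordellWeilRank)) := by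
  sorry

/-! ## Stub statements by name -/

namespace Statement

/-- Statement of `stub_factorOrders`. -/
abbrev stub_factorOrders : Prop := type_of% @ConjugatePigeonhole.stub_factorOrders
/-- Statement of `stub_balancedChart`. -/
abbrev stub_balancedChart : Prop := type_of% @ConjugatePigeonhole.stub_balancedChart
/-- Statement of `stub_atlas`. -/
abbrev stub_atlas : Prop := type_of% @ConjugatePigeonhole.stub_atlas

end Statement

/-! ## The composition (sorry-free) -/

/-- **`PlecticPointsLB_of`** — the three stub STATEMENTS imply the crux `PlecticLegs.PlecticPointsLB`, BY NAME.
Given `F` (degree `d ≥ 2`) and `V` with `r_an = d`: T puts `(F, V)` on a chart; on the balanced quadratic chart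
B concludes (`d = 2`); on a rigid factorisation A makes every factor of exact order one and the engine clause of T
concludes.  Axioms: propext, Classical.choice, Quot.sound. -/
theorem PlecticPointsLB_of (hA : Statement.stub_factorOrders) (hB : Statement.stub_balancedChart)
    (hT : Statement.stub_atlas) : PlecticPointsLB := by
  intro F _ _ _ V _ hd hran
  rcases hT F V hd hran with ⟨W, hW, h2, hV, hWe, hWde, hW0, hWd0, hg1, hg2⟩ | ⟨g, hg, hfac, hz, heng⟩
  · haveI := hW
    subst hV
    rw [h2] at hran ⊢
    exact hB W F h2 hWe hWde hW0 hWd0 hg1 hg2 hran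
  · exact heng (hA F V (Module.finrank ℚ F) g (by omega) hg hfac hz hran)

/-- The crux along this line, MODULO the three registered stubs. -/
theorem PlecticPointsLB_proof : PlecticPointsLB :=
  PlecticPointsLB_of stub_factorOrders stub_balancedChart stub_atlas

/-- Restated with the crux's full name (documentation). -/
example : Summit.BirchSwinnertonDyer.BirchSwinnertonDyer.Theses.PlecticLegs.PlecticPointsLB :=
  PlecticPointsLB_proof

end Summit.BirchSwinnertonDyer.BirchSwinnertonDyer.Cruxes.PlecticPointsLB.ConjugatePigeonhole
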